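import Mathlib
import Literature.Analysis.FluidPDE.NewtonPotential
import Literature.Analysis.FluidPDE.HarmonicMeanValue

/-!
# (N2′) THE MEAN-VALUE INEQUALITY WITH THE NEWTONIAN MAJORANT, ANNULAR-WEIGHT FORM (nsreg-p2 ROUND-46 v1.1 §7 (b) / SEEDS-R47
(R47-1) plate t49-N2 `NsregP2.R46b.SolidMeanValueUpper`, re-shaped onto the tree's localised Green representation)

Width piece for crux `EulerZoomLiouville.PowerGaugeEulerLiouville` (stmt-NavierStokesRegularity-19832), by name under LEAD 19832
(ns-typeII-p2); seat ns-sfl-p1 g7, `--supports stmt-NavierStokesRegularity-19832 --as helper`.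

(N2) as typed (`P(y) ≤ ⨍_{B(y,d)} P + (1/4π)∫_{B(y,d)} (−ΔP)⁺/‖x−y‖`, Folland §2E) needs Green's function of the BALL and the
divergence theorem on spheres, absent from Mathlib.  The tree already proves the boundary-free LOCALISED Green representation
`∫ Γ₀ Δφ = φ(0) − ∫ λ φ` (`Literature.Analysis.FluidPDE.integral_newtonNear_mul_laplacian`, Gilbarg–Trudinger (2.16)–(2.17)) with
`Γ₀ = θΓ ≤ 0` (`|Γ₀(z)| ≤ (4π‖z‖)⁻¹`, `Γ₀ = 0` off `‖z‖ < d`), `λ = Δ((1−θ)Γ)` smooth, supported in the annulus `d/2 ≤ ‖z‖ ≤ d`,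
`∫ λ = 1`, for the radial cutoff `θ = radialCutoff (d/2) d`.  Hence the ANNULAR-WEIGHT form of (N2), which serves K‴ §7(b) equally
(only `|∫ λ_d P| = O(d⁻²)‖P‖_{L^{3/2}}` is used there, and the sign of the weight never matters):

* `annularMeanValueUpper_abs` — `P(y) ≤ ∫ λ_d(z) P(y+z) dz + ∫ |Γ₀^{d/2,d}(z)| (−ΔP(y+z))⁺ dz`;
* `annularMeanValueUpper` — `P(y) ≤ ∫ λ_d(z) P(y+z) dz + ∫_{B(0,d)} (1/(4π‖z‖)) (−ΔP(y+z))⁺ dz`;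
* `abs_newtonFarLaplacian_half_le` — `|λ^{d/2,d}(z)| ≤ C_λ / d³` with `C_λ = sup |λ^{1/2,1}|` (scaling `newtonFarLaplacian_scale`),
  `newtonFarLaplacian_half_eq_zero` — `λ^{d/2,d}(z) = 0` unless `d/2 ≤ ‖z‖ ≤ d`, `integral_newtonFarLaplacian_half` — `∫ λ_d = 1`.

HONEST FRAMING: classical potential theory for `C²` functions on `ℝ³`, packaged for the K‴ plate; nothing here proves the crux E
(19832 OPEN), any door Target, or any Navier–Stokes statement. [cite: GilbargTrudinger2001, (2.16)–(2.17); folklore]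
-/

noncomputable section

open Set Filter Topology Metric Function MeasureTheory Real
open scoped RealInnerProductSpace Laplacian

set_option linter.dupNamespace false

namespace Summit.NavierStokesRegularity.NavierStokesRegularity.Theorems.PowerGaugeEulerLiouville.Condenser

open Literature.Analysis.FluidPDE

/-! ## The annular weight `λ_d = Δ((1 − θ_{d/2,d})Γ)` -/

/-- `∫ λ^{d/2,d} = 1`. [cite: GilbargTrudinger2001, (2.17)] -/
theorem integral_newtonFarLaplacian_half {d : ℝ} (hd : 0 < d) :
    ∫ z, newtonFarLaplacian (d / 2) d z = 1 :=
  integral_newtonFarLaplacian (half_pos hd) (by linarith)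

/-- `λ^{d/2,d}(z) = 0` unless `d/2 ≤ ‖z‖ ≤ d`. [folklore] -/
theorem newtonFarLaplacian_half_eq_zero {d : ℝ} (hd : 0 < d) {z : EuclideanSpace ℝ (Fin 3)}
    (hz : ‖z‖ < d / 2 ∨ d < ‖z‖) : newtonFarLaplacian (d / 2) d z = 0 := by
  rcases hz with h | h
  · exact newtonFarLaplacian_eq_zero_of_lt (half_pos hd).le (by linarith) h
  · exact newtonFarLaplacian_eq_zero_of_gt (half_pos hd).le (by linarith) h

/-- **Sup bound of the annular weight by scaling**: there is `C_λ ≥ 0` with `|λ^{d/2,d}(z)| ≤ C_λ / d³` for all `d > 0`, `z`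
(`λ^{d·½, d·1}(z) = d⁻³ λ^{½,1}(z/d)`, `newtonFarLaplacian_scale`). [folklore] -/
theorem exists_abs_newtonFarLaplacian_half_le :
    ∃ C : ℝ, 0 ≤ C ∧ ∀ d : ℝ, 0 < d → ∀ z : EuclideanSpace ℝ (Fin 3), |newtonFarLaplacian (d / 2) d z| ≤ C / d ^ 3 := by
  have hc : Continuous (newtonFarLaplacian (1 / 2 : ℝ) 1) := continuous_newtonFarLaplacian (by norm_num) (by norm_num)
  have hcs : HasCompactSupport (newtonFarLaplacian (1 / 2 : ℝ) 1) :=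
    hasCompactSupport_newtonFarLaplacian (by norm_num) (by norm_num)
  obtain ⟨C, hC⟩ := hc.bounded_above_of_compact_support hcs
  refine ⟨max C 0, le_max_right _ _, fun d hd z => ?_⟩
  have hscale := newtonFarLaplacian_scale hd (1 / 2 : ℝ) 1 z
  rw [mul_one, mul_one_div] at hscale
  rw [hscale, abs_mul, abs_of_pos (by positivity : (0 : ℝ) < d⁻¹ ^ 3), inv_pow, ← one_div, one_div_mul_eq_div]
  exact div_le_div_of_nonneg_right ((hC _).trans (le_max_left _ _)) (by positivity)

/-! ## The annular mean-value inequality with the Newtonian majorant -/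

/-- `Γ₀^{r₀,r₁} · g` is integrable for continuous `g` (`Γ₀ ∈ L¹` with support in `‖z‖ ≤ r₁`). [folklore] -/
theorem integrable_newtonNear_mul {r₀ r₁ : ℝ} (h₀ : 0 ≤ r₀) (h₁ : r₀ < r₁) {g : EuclideanSpace ℝ (Fin 3) → ℝ}
    (hg : Continuous g) : Integrable fun z => newtonNear r₀ r₁ z * g z := by
  have hΓi : Integrable (newtonNear r₀ r₁) := integrable_newtonNear h₀ h₁
  obtain ⟨M, hM⟩ : ∃ M, ∀ z ∈ closedBall (0 : EuclideanSpace ℝ (Fin 3)) r₁, ‖g z‖ ≤ M :=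
    (isCompact_closedBall 0 r₁).exists_bound_of_continuousOn hg.continuousOn
  refine Integrable.mono' (hΓi.norm.mul_const M)
    ((measurable_newtonNear _ _).aestronglyMeasurable.mul hg.aestronglyMeasurable) (Eventually.of_forall fun z => ?_)
  rw [norm_mul]
  by_cases hz : ‖z‖ ≤ r₁
  · exact mul_le_mul_of_nonneg_left (hM z (mem_closedBall_zero_iff.2 hz)) (norm_nonneg _)
  · rw [newtonNear_eq_zero h₀ h₁ (not_le.1 hz).le, norm_zero, zero_mul, zero_mul]

/-- `|Γ₀^{r₀,r₁}| · g` is integrable for continuous `g ≥ 0`. [folklore] -/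
theorem integrable_abs_newtonNear_mul {r₀ r₁ : ℝ} (h₀ : 0 ≤ r₀) (h₁ : r₀ < r₁) {g : EuclideanSpace ℝ (Fin 3) → ℝ}
    (hg : Continuous g) (hg0 : ∀ z, 0 ≤ g z) : Integrable fun z => |newtonNear r₀ r₁ z| * g z := by
  refine (integrable_newtonNear_mul h₀ h₁ hg).norm.congr (Eventually.of_forall fun z => ?_)
  simp only [norm_mul, Real.norm_eq_abs, abs_of_nonneg (hg0 z)]

/-- **(N2′, kernel form)**: for `P ∈ C²(ℝ³)`, `y ∈ ℝ³`, `d > 0`: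
`P(y) ≤ ∫ λ^{d/2,d}(z) P(y+z) dz + ∫ |Γ₀^{d/2,d}(z)| (−ΔP(y+z))⁺ dz`. [cite: GilbargTrudinger2001, (2.16)–(2.17)] -/
theorem annularMeanValueUpper_abs {P : EuclideanSpace ℝ (Fin 3) → ℝ} (hP : ContDiff ℝ 2 P)
    (y : EuclideanSpace ℝ (Fin 3)) {d : ℝ} (hd : 0 < d) :
    P y ≤ (∫ z, newtonFarLaplacian (d / 2) d z * P (y + z)) +
      ∫ z, |newtonNear (d / 2) d z| * max (-(Δ P) (y + z)) 0 := by
  have h₀ : 0 < d / 2 := half_pos hd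
  have h₁ : d / 2 < d := by linarith
  set φ : EuclideanSpace ℝ (Fin 3) → ℝ := fun z => P (y + z) with hφ
  have hφc : ContDiff ℝ 2 φ := hP.comp (contDiff_const.add contDiff_id)
  have hΔ : ∀ z, (Δ φ) z = (Δ P) (y + z) := fun z => laplacian_comp_const_add P y z
  have hΔc : Continuous fun z => (Δ P) (y + z) :=
    (Literature.Analysis.FluidPDE.continuous_laplacian hP).comp (continuous_const.add continuous_id)
  -- the localised Green representation `∫ Γ₀ Δφ = φ 0 − ∫ λ φ`
  have hid := integral_newtonNear_mul_laplacian h₀ h₁ hφc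
  simp_rw [hΔ] at hid
  have hφ0 : φ 0 = P y := by simp [hφ]
  rw [hφ0] at hid
  -- pointwise: `Γ₀ ΔP ≤ |Γ₀| (−ΔP)⁺` (`Γ₀ ≤ 0`)
  have hpt : ∀ z, newtonNear (d / 2) d z * (Δ P) (y + z) ≤ |newtonNear (d / 2) d z| * max (-(Δ P) (y + z)) 0 := by
    intro z
    have hΓ0 : newtonNear (d / 2) d z ≤ 0 := by
      rw [newtonNear, newtonKernel_eq]
      exact mul_nonpos_of_nonneg_of_nonpos (radialCutoff_nonneg _ _ _)
        (neg_nonpos.2 (inv_nonneg.2 (by positivity)))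
    rw [abs_of_nonpos hΓ0]
    nlinarith [le_max_left (-(Δ P) (y + z)) 0, le_max_right (-(Δ P) (y + z)) 0]
  have hi1 : Integrable fun z => newtonNear (d / 2) d z * (Δ P) (y + z) := integrable_newtonNear_mul h₀.le h₁ hΔc
  have hi2 : Integrable fun z => |newtonNear (d / 2) d z| * max (-(Δ P) (y + z)) 0 :=
    integrable_abs_newtonNear_mul h₀.le h₁ (hΔc.neg.max continuous_const) fun z => le_max_right _ _
  have hle := integral_mono hi1 hi2 hpt
  have hφP : (fun z => newtonFarLaplacian (d / 2) d z * φ z) = fun z => newtonFarLaplacian (d / 2) d z * P (y + z) := rfl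
  rw [hφP] at hid
  linarith

/-- **(N2′) THE ANNULAR MEAN-VALUE INEQUALITY WITH THE NEWTONIAN MAJORANT**: for `P ∈ C²(ℝ³)`, `y ∈ ℝ³`, `d > 0`:
`P(y) ≤ ∫ λ^{d/2,d}(z) P(y+z) dz + ∫_{B(0,d)} (1/(4π‖z‖)) (−ΔP(y+z))⁺ dz`
(`|Γ₀| ≤ (4π‖z‖)⁻¹` on `‖z‖ < d` and `Γ₀ = 0` beyond; the majorant on the ball is integrable because it equals
`|Γ₀^{d,2d}| (−ΔP(y+·))⁺` there). [cite: GilbargTrudinger2001, (2.16)–(2.17)] -/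
theorem annularMeanValueUpper {P : EuclideanSpace ℝ (Fin 3) → ℝ} (hP : ContDiff ℝ 2 P)
    (y : EuclideanSpace ℝ (Fin 3)) {d : ℝ} (hd : 0 < d) :
    P y ≤ (∫ z, newtonFarLaplacian (d / 2) d z * P (y + z)) +
      ∫ z in ball (0 : EuclideanSpace ℝ (Fin 3)) d, (1 / (4 * π * ‖z‖)) * max (-(Δ P) (y + z)) 0 := by
  have h₀ : 0 < d / 2 := half_pos hd
  have h₁ : d / 2 < d := by linarith
  have hfirst := annularMeanValueUpper_abs hP y hd
  have hΔc : Continuous fun z => (Δ P) (y + z) :=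
    (Literature.Analysis.FluidPDE.continuous_laplacian hP).comp (continuous_const.add continuous_id)
  set g : EuclideanSpace ℝ (Fin 3) → ℝ := fun z => max (-(Δ P) (y + z)) 0 with hgdef
  have hgc : Continuous g := hΔc.neg.max continuous_const
  have hg0 : ∀ z, 0 ≤ g z := fun z => le_max_right _ _
  -- the majorant on the ball, as a function on `ℝ³`: it is `𝟙_{B(0,d)} |Γ₀^{d,2d}| g`, hence integrable
  set F : EuclideanSpace ℝ (Fin 3) → ℝ :=
    (ball (0 : EuclideanSpace ℝ (Fin 3)) d).indicator fun z => (1 / (4 * π * ‖z‖)) * g z with hFdef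
  have hFeq : F = (ball (0 : EuclideanSpace ℝ (Fin 3)) d).indicator fun z => |newtonNear d (2 * d) z| * g z := by
    funext z
    by_cases hz : z ∈ ball (0 : EuclideanSpace ℝ (Fin 3)) d
    · rw [hFdef, indicator_of_mem hz, indicator_of_mem hz,
        newtonNear_eq_newtonKernel hd.le (by linarith) (mem_ball_zero_iff.1 hz).le, abs_newtonKernel, one_div]
    · rw [hFdef, indicator_of_notMem hz, indicator_of_notMem hz]
  have hFi : Integrable F := by
    rw [hFeq]
    exact (integrable_abs_newtonNear_mul hd.le (by linarith : d < 2 * d) hgc hg0).indicator measurableSet_ball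
  -- pointwise domination `|Γ₀^{d/2,d}| g ≤ F`
  have hpt : ∀ z, |newtonNear (d / 2) d z| * g z ≤ F z := by
    intro z
    by_cases hz : z ∈ ball (0 : EuclideanSpace ℝ (Fin 3)) d
    · rw [hFdef, indicator_of_mem hz, one_div]
      exact mul_le_mul_of_nonneg_right (abs_newtonNear_le _ _ z) (hg0 z)
    · have hz' : d ≤ ‖z‖ := not_lt.1 (fun h => hz (mem_ball_zero_iff.2 h))
      rw [hFdef, indicator_of_notMem hz, newtonNear_eq_zero h₀.le h₁ hz', abs_zero, zero_mul]
  have hi2 : Integrable fun z => |newtonNear (d / 2) d z| * g z := integrable_abs_newtonNear_mul h₀.le h₁ hgc hg0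
  have hle : ∫ z, |newtonNear (d / 2) d z| * g z ≤ ∫ z, F z := integral_mono hi2 hFi hpt
  have hF : ∫ z, F z = ∫ z in ball (0 : EuclideanSpace ℝ (Fin 3)) d, (1 / (4 * π * ‖z‖)) * g z := by
    rw [hFdef, integral_indicator measurableSet_ball]
  rw [hF] at hle
  exact hfirst.trans (by linarith)

end Summit.NavierStokesRegularity.NavierStokesRegularity.Theorems.PowerGaugeEulerLiouville.Condenser

end
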